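import Mathlib
import Summits.Ventures.PercRepro.TriangleCapTriangleFreeTwoA

/-!
# PercRepro — TWO BELOW THE DIAGONAL ON TRIANGLE-FREE GRAPHS: `Σ_v d(v)² + 2(k − 3) ≤ m·k` for every
triangle-free graph in the dense corner that is not a complete bipartite graph minus at most one edge
(p3, gen 36; part 39)

TriangleCapMantelStability (§10at) gives the gap `k − 2` off the complete bipartite graphs; TriangleCapBipartiteTwo
the gap `2(k − 3)` on every bipartite spanning graph with two missing cross pairs.  This module adds the
NON-bipartite triangle-free graphs, with the `X = N(v)`, `Y = N(u)`, `Z = V ∖ (X ∪ Y)` split of §10at along an edge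
`u v` with `d(u) ≥ 2` (so `|Z| ≤ k − 3`) and the sharper per-`z` count of TriangleCapTriangleFreeTwoA: the pairs
`(x, v)`, `x ∉ N(z)`, and `(u, y)`, `y ∉ N(z)`, are far from `z`, and every edge `z x`, `x ∈ X`, has the whole of
`X ∖ N(z)` in its deficit, so each `z` pays `|X ∖ N(z)|·(|N(z) ∩ X| + 1) + |Y ∖ N(z)|·(|N(z) ∩ Y| + 1) − 1 ≥ |X| + |Y| − 1`
(`four_mul_le_sum_deficit_of_not_bipartite`):

* `|Z| ≥ 2`: `|Z| (k − |Z| − 1) ≥ 2 (k − 3)`;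
* `|Z| = 1` with a non-adjacent `X`–`Y` pair: §10at's count of that pair adds `|X| + |Y| − 2 = k − 3`;
* `|Z| = 1` with all `X`–`Y` pairs adjacent, or `|Z| = 0`: the graph is bipartite spanning — excluded.

* **`triangle_free_stability_two`** — a triangle-free graph on `k` vertices with `m ≥ 2k − 3` edges that is not
  bipartite spanning with `≤ 1` missing cross pair has `Σ_v d(v)² + 2 (k − 3) ≤ m·k`
  (`triangle_free_stability_two_cherries` in cherries);
* **`two_below_diagonal_cliqueFree_exact`** — for `1 ≤ a`, `a + 2 ≤ k`, `m = a(k − a) − 2 ≥ 2k − 3` with `m`, `m + 1`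
  not of the form `a′(k − a′)`: the maximum of `2·Σ_v C(d(v), 2)` over the TRIANGLE-FREE graphs on `Fin k` with `m`
  edges IS `m (k − 2) − 2 (k − 3)`, by `K_{a, k−a}` minus two edges at one vertex — the sub-diagonal `r = 2` of the
  closed form P3-TRIANGLE-CAP.md §10av on the triangle-free class: `(8,13) 34 · (9,16) 50 · (10,22) 81 · (11,22) 91 · (12,25) 116`.

Numbers first (mining/p3/g36/tfnb.c): every triangle-free labelled graph on `k = 7` (133,501) and `k = 8` (4,682,270)
vertices — the non-bipartite ones have minimum gap `m·k − Σ_v d(v)² = 3k − 10` (11 / 14), attained by `K_{2,k−3}`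
minus an edge plus a vertex adjacent to both ends of the missing pair; `3k − 10 ≥ 2(k − 3)` with slack `k − 4`.
Axioms: standard.
-/

namespace PercRepro

namespace TriangleCap

namespace C047

open Finset

variable {V : Type*} [Fintype V] [DecidableEq V]

/-- **THE NON-BIPARTITE CORE:** a triangle-free graph that is not bipartite spanning, with an edge `u v` and
`d(u) ≥ 2`, has ordered deficit sum `≥ 4 (k − 3)`. -/
theorem four_mul_le_sum_deficit_of_not_bipartite (D : SimpleGraph V) [DecidableRel D.Adj]
    (hfree : D.CliqueFree 3) {u v : V} (huv : D.Adj u v) (hu2 : 2 ≤ deg D u)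
    (hnb : ¬ ∃ A : Finset V, ∀ x y, D.Adj x y → (x ∈ A ↔ y ∉ A)) :
    4 * (Fintype.card V - 3) ≤ ∑ p ∈ adjPairsAll D, deficit D p := by
  -- no triangles
  have htri : ∀ a b c, D.Adj a b → D.Adj a c → D.Adj b c → False := fun a b c hab hac hbc =>
    hfree {a, b, c} (SimpleGraph.is3Clique_triple_iff.mpr ⟨hab, hac, hbc⟩)
  -- the three classes of vertices
  obtain ⟨X, hX⟩ : ∃ X : Finset V, X = univ.filter (fun w => D.Adj v w) := ⟨_, rfl⟩
  obtain ⟨Y, hY⟩ : ∃ Y : Finset V, Y = univ.filter (fun w => D.Adj u w) := ⟨_, rfl⟩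
  obtain ⟨Z, hZ⟩ : ∃ Z : Finset V, Z = univ.filter (fun w => ¬ D.Adj v w ∧ ¬ D.Adj u w) := ⟨_, rfl⟩
  have memX : ∀ w, w ∈ X ↔ D.Adj v w := fun w => by rw [hX, mem_filter]; simp only [mem_univ, true_and]
  have memY : ∀ w, w ∈ Y ↔ D.Adj u w := fun w => by rw [hY, mem_filter]; simp only [mem_univ, true_and]
  have memZ : ∀ w, w ∈ Z ↔ ¬ D.Adj v w ∧ ¬ D.Adj u w := fun w => by
    rw [hZ, mem_filter]; simp only [mem_univ, true_and]
  have hXY : ∀ w, D.Adj v w → ¬ D.Adj u w := fun w hv hu => htri u v w huv hu hv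
  have hXind : ∀ a b, D.Adj v a → D.Adj v b → ¬ D.Adj a b := fun a b ha hb hab => htri v a b ha hb hab
  have hYind : ∀ a b, D.Adj u a → D.Adj u b → ¬ D.Adj a b := fun a b ha hb hab => htri u a b ha hb hab
  have huX : u ∈ X := (memX u).mpr huv.symm
  have hvY : v ∈ Y := (memY v).mpr huv
  have hYcard : Y.card = deg D u := by rw [hY]; rfl
  have hcard : X.card + Y.card + Z.card = Fintype.card V := by
    rw [hX, hY, hZ]
    have h1 := card_filter_add_card_filter_not (s := (univ : Finset V)) (fun w => D.Adj v w)
    have h2 := card_filter_add_card_filter_not (s := univ.filter (fun w => ¬ D.Adj v w))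
      (fun w => D.Adj u w)
    rw [filter_filter, filter_filter] at h2
    have e1 : (univ.filter (fun w => ¬ D.Adj v w ∧ D.Adj u w)) = univ.filter (fun w => D.Adj u w) := by
      ext w
      simp only [mem_filter, mem_univ, true_and]
      exact ⟨fun h => h.2, fun h => ⟨fun hv => hXY w hv h, h⟩⟩
    rw [e1] at h2
    rw [card_univ] at h1
    omega
  -- the two classes of ordered adjacent pairs
  obtain ⟨A₁, hA₁⟩ : ∃ A₁ : Finset (V × V),
      A₁ = (adjPairsAll D).filter (fun p => D.Adj v p.1 ∧ D.Adj u p.2) := ⟨_, rfl⟩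
  obtain ⟨A₃, hA₃⟩ : ∃ A₃ : Finset (V × V), A₃ = (adjPairsAll D).filter
      (fun p => (¬ D.Adj v p.1 ∧ ¬ D.Adj u p.1) ∧ (D.Adj v p.2 ∨ D.Adj u p.2)) := ⟨_, rfl⟩
  have memA₁ : ∀ p, p ∈ A₁ ↔ D.Adj p.1 p.2 ∧ D.Adj v p.1 ∧ D.Adj u p.2 := fun p => by
    rw [hA₁, mem_filter, mem_adjPairsAll]
  have memA₃ : ∀ p, p ∈ A₃ ↔ D.Adj p.1 p.2 ∧ (¬ D.Adj v p.1 ∧ ¬ D.Adj u p.1) ∧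
      (D.Adj v p.2 ∨ D.Adj u p.2) := fun p => by
    rw [hA₃, mem_filter, mem_adjPairsAll]
  have hsplit : 2 * ∑ p ∈ A₁, deficit D p + 2 * ∑ p ∈ A₃, deficit D p ≤
      ∑ p ∈ adjPairsAll D, deficit D p := by
    have h := sum_four_filters_le (adjPairsAll D) (deficit D)
      (fun p => D.Adj v p.1 ∧ D.Adj u p.2) (fun p => D.Adj u p.1 ∧ D.Adj v p.2)
      (fun p => (¬ D.Adj v p.1 ∧ ¬ D.Adj u p.1) ∧ (D.Adj v p.2 ∨ D.Adj u p.2))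
      (fun p => (D.Adj v p.1 ∨ D.Adj u p.1) ∧ (¬ D.Adj v p.2 ∧ ¬ D.Adj u p.2))
      (fun p h2 h1 => hXY p.1 h1.1 h2.1) (fun p h3 h1 => h3.1.1 h1.1) (fun p h3 h2 => h3.1.2 h2.1)
      (fun p h4 h1 => h4.2.2 h1.2) (fun p h4 h2 => h4.2.1 h2.2)
      (fun p h4 h3 => by rcases h4.1 with h | h; exact h3.1.1 h; exact h3.1.2 h)
    have h12 := sum_deficit_filter_swap D (fun p : V × V => D.Adj u p.1 ∧ D.Adj v p.2)
      (fun p : V × V => D.Adj v p.1 ∧ D.Adj u p.2) (fun p => by simp only [Prod.fst_swap, Prod.snd_swap]; exact and_comm)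
    have h34 := sum_deficit_filter_swap D
      (fun p : V × V => (D.Adj v p.1 ∨ D.Adj u p.1) ∧ (¬ D.Adj v p.2 ∧ ¬ D.Adj u p.2))
      (fun p : V × V => (¬ D.Adj v p.1 ∧ ¬ D.Adj u p.1) ∧ (D.Adj v p.2 ∨ D.Adj u p.2))
      (fun p => by simp only [Prod.fst_swap, Prod.snd_swap]; exact and_comm)
    rw [h12, h34] at h
    rw [hA₁, hA₃]
    omega
  -- the pointwise bound on the class `X × Y`
  have hA1 : ∀ p ∈ A₁,
      (X.filter (fun w => ¬ D.Adj p.2 w)).card + (Y.filter (fun w => ¬ D.Adj p.1 w)).card +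
        (Z.filter (fun w => ¬ D.Adj p.1 w ∧ ¬ D.Adj p.2 w)).card ≤ deficit D p := by
    intro p hp
    obtain ⟨_, hx, hy⟩ := (memA₁ p).mp hp
    unfold deficit
    have hsub : X.filter (fun w => ¬ D.Adj p.2 w) ∪ Y.filter (fun w => ¬ D.Adj p.1 w) ∪
        Z.filter (fun w => ¬ D.Adj p.1 w ∧ ¬ D.Adj p.2 w) ⊆
          univ.filter (fun x => ¬ D.Adj p.1 x ∧ ¬ D.Adj p.2 x) := by
      intro w hw
      rw [mem_filter]
      refine ⟨mem_univ _, ?_⟩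
      simp only [mem_union, mem_filter] at hw
      rcases hw with (⟨hw1, hw2⟩ | ⟨hw1, hw2⟩) | ⟨_, hw2⟩
      · exact ⟨hXind p.1 w hx ((memX w).mp hw1), hw2⟩
      · exact ⟨hw2, hYind p.2 w hy ((memY w).mp hw1)⟩
      · exact hw2
    have hd1 : Disjoint (X.filter (fun w => ¬ D.Adj p.2 w)) (Y.filter (fun w => ¬ D.Adj p.1 w)) := by
      rw [disjoint_left]
      intro w hw1 hw2
      rw [mem_filter] at hw1 hw2
      exact hXY w ((memX w).mp hw1.1) ((memY w).mp hw2.1)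
    have hd2 : Disjoint (X.filter (fun w => ¬ D.Adj p.2 w) ∪ Y.filter (fun w => ¬ D.Adj p.1 w))
        (Z.filter (fun w => ¬ D.Adj p.1 w ∧ ¬ D.Adj p.2 w)) := by
      rw [disjoint_left]
      intro w hw1 hw2
      rw [mem_filter] at hw2
      have hw2' := (memZ w).mp hw2.1
      simp only [mem_union, mem_filter] at hw1
      rcases hw1 with ⟨h, _⟩ | ⟨h, _⟩
      · exact hw2'.1 ((memX w).mp h)
      · exact hw2'.2 ((memY w).mp h)
    have := card_le_card hsub
    rw [card_union_of_disjoint hd2, card_union_of_disjoint hd1] at this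
    exact this
  have hA1sum : ∑ p ∈ A₁, (X.filter (fun w => ¬ D.Adj p.2 w)).card +
      ∑ p ∈ A₁, (Y.filter (fun w => ¬ D.Adj p.1 w)).card +
        ∑ p ∈ A₁, (Z.filter (fun w => ¬ D.Adj p.1 w ∧ ¬ D.Adj p.2 w)).card ≤
          ∑ p ∈ A₁, deficit D p := by
    rw [← sum_add_distrib, ← sum_add_distrib]
    exact sum_le_sum hA1
  -- THE `Z` ACCOUNTING (TriangleCapTriangleFreeTwoA): far pairs, the edges at `z`, and the per-`z` arithmetic
  have hfarZ : ∑ p ∈ A₁, (Z.filter (fun w => ¬ D.Adj p.1 w ∧ ¬ D.Adj p.2 w)).card =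
      ∑ z ∈ Z, (A₁.filter (fun p => ¬ D.Adj p.1 z ∧ ¬ D.Adj p.2 z)).card := by
    simp only [card_filter]
    rw [sum_comm]
  have hfarsum : ∑ z ∈ Z, ((X.filter (fun x => ¬ D.Adj z x)).card + (Y.filter (fun y => ¬ D.Adj z y)).card) ≤
      ∑ p ∈ A₁, (Z.filter (fun w => ¬ D.Adj p.1 w ∧ ¬ D.Adj p.2 w)).card + Z.card := by
    rw [hfarZ, card_eq_sum_ones, ← sum_add_distrib]
    apply sum_le_sum
    intro z hz
    have hz' := (memZ z).mp hz
    exact far_pairs_lower D huv X Y memX memY A₁ memA₁ hz'.1 hz'.2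
  have hA3sum := edges_at_Z_lower D htri huv X Y Z memX memY memZ A₃ memA₃
  have hZtotal : Z.card * (X.card + Y.card) ≤
      ∑ p ∈ A₁, (Z.filter (fun w => ¬ D.Adj p.1 w ∧ ¬ D.Adj p.2 w)).card + ∑ p ∈ A₃, deficit D p + Z.card := by
    have hper : ∀ z ∈ Z, X.card + Y.card ≤
        ((X.filter (fun w => D.Adj z w)).card * (X.filter (fun x => ¬ D.Adj z x)).card +
          (Y.filter (fun w => D.Adj z w)).card * (Y.filter (fun y => ¬ D.Adj z y)).card) +
        ((X.filter (fun x => ¬ D.Adj z x)).card + (Y.filter (fun y => ¬ D.Adj z y)).card) := by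
      intro z hz
      have hz' := (memZ z).mp hz
      exact per_z_arith D X Y huX hvY hz'.1 hz'.2
    have h := sum_le_sum hper
    rw [sum_const, smul_eq_mul, sum_add_distrib] at h
    omega
  have hY2 : 2 ≤ Y.card := by rw [hYcard]; exact hu2
  have hX1 : 1 ≤ X.card := card_pos.mpr ⟨u, huX⟩
  -- assembly
  have hkey : 2 * (Fintype.card V - 3) ≤ ∑ p ∈ A₁, deficit D p + ∑ p ∈ A₃, deficit D p := by
    by_cases hZ0 : Z.card = 0
    · -- `Z = ∅`: the graph is bipartite spanning with parts `X`, `Y`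
      exfalso
      apply hnb
      have hZe : ∀ w, D.Adj v w ∨ D.Adj u w := by
        intro w
        by_contra hw
        have : w ∈ Z := (memZ w).mpr (not_or.mp hw)
        rw [card_eq_zero] at hZ0
        rw [hZ0] at this
        exact notMem_empty w this
      exact bipartite_of_Z_empty D htri (u := u) X memX hZe
    by_cases hZ1 : Z.card = 1
    · -- `|Z| = 1`
      by_cases hcase : ∃ x ∈ X, ∃ y ∈ Y, ¬ D.Adj x y
      · -- a non-adjacent pair `x₀ ∈ X`, `y₀ ∈ Y` pays `|X| + |Y| − 2` inside `X × Y`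
        obtain ⟨x₀, hx₀, y₀, hy₀, hxy⟩ := hcase
        have hpair := xy_pair_lower D huv X Y memX memY A₁ memA₁ hx₀ hy₀ hxy
        rw [hZ1] at hZtotal
        omega
      · -- every `X`–`Y` pair adjacent and `Z = {z}`: bipartite spanning, excluded
        exfalso
        have hall : ∀ x ∈ X, ∀ y ∈ Y, D.Adj x y := fun x hx y hy =>
          Classical.byContradiction (fun h => hcase ⟨x, hx, y, hy, h⟩)
        obtain ⟨z, hzZ⟩ : ∃ z, z ∈ Z := by
          have : Z.Nonempty := card_pos.mp (by omega)
          exact this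
        have hZz : ∀ w, w ∈ Z → w = z := by
          intro w hw
          rw [card_eq_one] at hZ1
          obtain ⟨a, ha⟩ := hZ1
          rw [ha, mem_singleton] at hw hzZ
          rw [hw, hzZ]
        have hclass : ∀ w, D.Adj v w ∨ D.Adj u w ∨ w = z := by
          intro w
          by_cases h1 : D.Adj v w
          · exact Or.inl h1
          by_cases h2 : D.Adj u w
          · exact Or.inr (Or.inl h2)
          exact Or.inr (Or.inr (hZz w ((memZ w).mpr ⟨h1, h2⟩)))
        exact hnb (bipartite_of_Z_singleton D htri (u := u) X Y memX memY hclass hall)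
    · -- `|Z| ≥ 2`: `|Z| (|X| + |Y| − 1) ≥ 2 (k − 3)` since `|X| + |Y| ≥ 3`
      have hZ2 : 2 ≤ Z.card := by omega
      have hXY3 : 3 ≤ X.card + Y.card := by omega
      obtain ⟨z', hz'⟩ : ∃ z', Z.card = z' + 2 := ⟨Z.card - 2, by omega⟩
      obtain ⟨s', hs'⟩ : ∃ s', X.card + Y.card = s' + 3 := ⟨X.card + Y.card - 3, by omega⟩
      rw [hz', hs'] at hZtotal
      rw [← hcard, hs', hz']
      have e : s' + 3 + (z' + 2) - 3 = s' + z' + 2 := by omega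
      rw [e]
      have hexp : (z' + 2) * (s' + 3) = z' * s' + 3 * z' + 2 * s' + 6 := by ring
      rw [hexp] at hZtotal
      omega
  omega

omit [DecidableEq V] in
/-- A graph with `2k ≤ m + 3` and `k ≥ 4` has a vertex of degree `≥ 2`. -/
theorem exists_deg_two_of_dense (D : SimpleGraph V) [DecidableRel D.Adj] (hk : 4 ≤ Fintype.card V)
    (hm : 2 * Fintype.card V ≤ D.edgeFinset.card + 3) : ∃ u, 2 ≤ deg D u := by
  by_contra h
  have h1 : ∀ u ∈ (univ : Finset V), deg D u ≤ 1 := fun u _ => by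
    by_contra h'
    exact h ⟨u, by omega⟩
  have h2 := sum_le_sum h1
  rw [sum_deg_eq, sum_const, smul_eq_mul, mul_one, card_univ] at h2
  omega

/-- **TWO BELOW THE DIAGONAL, TRIANGLE-FREE:** a triangle-free graph on `k` vertices with `m ≥ 2k − 3` edges that
is not bipartite spanning with at most one missing cross pair has `Σ_v d(v)² + 2 (k − 3) ≤ m·k`. -/
theorem triangle_free_stability_two (D : SimpleGraph V) [DecidableRel D.Adj] (hfree : D.CliqueFree 3)
    (hm : 2 * Fintype.card V ≤ D.edgeFinset.card + 3)
    (hnot : ¬ ∃ A : Finset V, (∀ x y, D.Adj x y → (x ∈ A ↔ y ∉ A)) ∧ (missing D A Aᶜ).card ≤ 1) :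
    ∑ v, deg D v * deg D v + 2 * (Fintype.card V - 3) ≤ D.edgeFinset.card * Fintype.card V := by
  by_cases hb : ∃ A : Finset V, ∀ x y, D.Adj x y → (x ∈ A ↔ y ∉ A)
  · obtain ⟨A, hA⟩ := hb
    have hN : 2 ≤ (missing D A Aᶜ).card := by
      by_contra h
      exact hnot ⟨A, hA, by omega⟩
    exact bipartite_stability_two D A hA hN (by omega)
  · have hid := two_mul_sum_deg_sq_add_sum_deficit D
    rw [card_triangles3_eq_zero_of_cliqueFree D hfree] at hid
    have hid2 : 2 * ∑ v, deg D v * deg D v + ∑ p ∈ adjPairsAll D, deficit D p =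
        2 * (D.edgeFinset.card * Fintype.card V) := by rw [hid]; ring
    by_cases hk : Fintype.card V ≤ 3
    · have : Fintype.card V - 3 = 0 := by omega
      rw [this]
      omega
    · obtain ⟨u, hu⟩ := exists_deg_two_of_dense D (by omega) hm
      have hne : (univ.filter (fun w => D.Adj u w)).Nonempty := by
        apply card_pos.mp
        show 0 < deg D u
        omega
      obtain ⟨v, hv⟩ := hne
      rw [mem_filter] at hv
      have := four_mul_le_sum_deficit_of_not_bipartite D hfree hv.2 hu hb
      omega

/-- `triangle_free_stability_two` in cherries: `2·Σ_v C(d(v), 2) + 2m + 2 (k − 3) ≤ m·k`. -/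
theorem triangle_free_stability_two_cherries (D : SimpleGraph V) [DecidableRel D.Adj] (hfree : D.CliqueFree 3)
    (hm : 2 * Fintype.card V ≤ D.edgeFinset.card + 3)
    (hnot : ¬ ∃ A : Finset V, (∀ x y, D.Adj x y → (x ∈ A ↔ y ∉ A)) ∧ (missing D A Aᶜ).card ≤ 1) :
    2 * cherries D + 2 * D.edgeFinset.card + 2 * (Fintype.card V - 3) ≤
      D.edgeFinset.card * Fintype.card V := by
  have h1 := triangle_free_stability_two D hfree hm hnot
  have h2 := two_mul_cherries_add D
  have h3 := sum_deg_eq D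
  omega

/-- **TWO BELOW THE DIAGONAL, TRIANGLE-FREE, EXACT:** for `1 ≤ a`, `a + 2 ≤ k`, `m = a(k − a) − 2 ≥ 2k − 3` with `m`
and `m + 1` not of the form `a′(k − a′)`, the maximum of `2·Σ_v C(d(v), 2)` over the triangle-free graphs on `Fin k`
with `m` edges is `m (k − 2) − 2 (k − 3)`, attained by `K_{a, k−a}` minus two edges at one vertex. -/
theorem two_below_diagonal_cliqueFree_exact (k a : ℕ) (ha : 1 ≤ a) (hak : a + 2 ≤ k)
    (hdense : 2 * k ≤ a * (k - a) - 2 + 3)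
    (hm : ∀ a', a' ≤ k → a * (k - a) - 2 ≠ a' * (k - a') ∧ a * (k - a) - 1 ≠ a' * (k - a')) :
    (∀ (D : SimpleGraph (Fin k)) [DecidableRel D.Adj], D.CliqueFree 3 →
        D.edgeFinset.card = a * (k - a) - 2 →
        2 * cherries D + 2 * (k - 3) ≤ (a * (k - a) - 2) * (k - 2)) ∧
      ∃ (D : SimpleGraph (Fin k)) (_ : DecidableRel D.Adj), D.CliqueFree 3 ∧
        D.edgeFinset.card = a * (k - a) - 2 ∧ 2 * cherries D + 2 * (k - 3) = (a * (k - a) - 2) * (k - 2) := by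
  have hka : 2 ≤ a * (k - a) := by
    obtain ⟨c, hc⟩ : ∃ c, k = a + 2 + c := ⟨k - a - 2, by omega⟩
    subst hc
    have : a + 2 + c - a = 2 + c := by omega
    rw [this]
    nlinarith
  obtain ⟨m, hmm⟩ : ∃ m, a * (k - a) = m + 2 := ⟨a * (k - a) - 2, by omega⟩
  have e1 : a * (k - a) - 2 = m := by omega
  have e2 : a * (k - a) - 1 = m + 1 := by omega
  rw [e1] at hdense hm ⊢
  rw [e2] at hm
  constructor
  · intro D _ hfree hD
    have hcard : Fintype.card (Fin k) = k := Fintype.card_fin k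
    have hnot : ¬ ∃ A : Finset (Fin k), (∀ x y, D.Adj x y → (x ∈ A ↔ y ∉ A)) ∧ (missing D A Aᶜ).card ≤ 1 := by
      rintro ⟨A, hA, hN⟩
      have hNX := card_missing_add_card_edges D A hA
      have hXc : Aᶜ.card = k - A.card := by
        have := card_add_card_compl A
        rw [hcard] at this
        omega
      have hXk : A.card ≤ k := by
        have := card_le_univ A
        rwa [hcard] at this
      obtain ⟨h1, h2⟩ := hm A.card hXk
      rw [hXc, hD] at hNX
      have : (missing D A Aᶜ).card = 0 ∨ (missing D A Aᶜ).card = 1 := by omega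
      rcases this with h | h
      · rw [h] at hNX; exact h1 (by omega)
      · rw [h] at hNX; exact h2 (by omega)
    have := triangle_free_stability_two_cherries D hfree (by rw [hcard, hD]; exact hdense) hnot
    rw [hcard, hD] at this
    obtain ⟨k', hk'⟩ : ∃ k', k = k' + 3 := ⟨k - 3, by omega⟩
    subst hk'
    have e3 : k' + 3 - 3 = k' := by omega
    have e4 : k' + 3 - 2 = k' + 1 := by omega
    rw [e3] at this ⊢
    rw [e4]
    nlinarith
  · refine ⟨bipMinusStar k a 2, inferInstance,
      cliqueFree_of_bipartite _ (univ.filter (fun i : Fin k => i.val < a)) (bipMinusStar_bipartite k a 2), ?_, ?_⟩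
    · have := card_edges_bipMinusStar k a 2 ha hak
      omega
    · have h := two_mul_cherries_bipMinusStar k a 2 ha hak (by omega)
      rw [hmm] at h
      obtain ⟨k', hk'⟩ : ∃ k', k = k' + 3 := ⟨k - 3, by omega⟩
      subst hk'
      have e3 : k' + 3 - 3 = k' := by omega
      have e4 : k' + 3 - 2 = k' + 1 := by omega
      have e5 : 2 * (k' + 3) - 2 - 3 = 2 * k' + 1 := by omega
      rw [e4, e5] at h
      rw [e3, e4]
      nlinarith

end C047

end TriangleCap

end PercRepro
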